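import Summits.Langlands.Langlands.Statement
import Literature.NumberTheory.Automorphic.Sweep1SymmetricPower
import HarnessLib

/-!
# F4 ON-PATH LEMMA — line `BianchiSymmPowerGaloisToAutomorphic` (crux `ReciprocityUpToIrreducibility`, item stmt-Langlands-14328)
# forward generator G4 ladder-down, generation 29 — `Langlands → rung` (0 sorry)

`symmPowerRAGaloisToAutomorphicOn_of_langlands : Langlands → SymmPowerRAGaloisToAutomorphicOn 𝒦` for EVERY class
`𝒦` of number fields (clause (B) of the summit at rank `m + 1` for the summit's reciprocity datum, applied to the
given irreducible de Rham `ρ`; its a.e. unramifiedness is read off the `Symᵐ`-compatibility hypothesis), hence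
`BianchiSymmPowerGaloisToAutomorphic_of_Langlands : Langlands → BianchiSymmPowerGaloisToAutomorphic` (the rung is ON
THE PATH: a consequence of S pinned below by the F3 witness `Lines/BianchiSymmPowerGaloisToAutomorphic_special.lean`,
so the [nec]-trap is discharged).  Dial monotonicity `symmPowerRAGaloisToAutomorphicOn_mono` (bigger class ⇒
stronger) is here too.  The crux-side version `E → rung` lives in the skeleton (it needs the route module).
-/

noncomputable section

set_option linter.dupNamespace false

open scoped MatrixGroups Matrix NumberField Classical Polynomial
open Filter IsDedekindDomain Field Polynomial
open Literature.NumberTheory.Automorphic Literature.NumberTheory.GaloisRepresentations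
open Literature.NumberTheory.PAdicHodge
open Summit.Langlands

namespace Summit.Langlands.Langlands.Cruxes.ReciprocityUpToIrreducibility.BianchiSymmPowerGaloisToAutomorphic

/-! ## 1. The dial: classes of number fields -/

/-- The class of totally real number fields (the floor's class). [folklore] -/
def TotallyRealClass : ∀ (K : Type) [Field K] [NumberField K], Prop :=
  fun K _ _ => NumberField.IsTotallyReal K

/-- `K` is imaginary quadratic: totally complex of degree `2` (the summit's convention, cf. routes
`ImaginaryQuadraticAnchor`, `FifteenLocusEisenstein`). [folklore] -/
def IsImaginaryQuadratic (K : Type) [Field K] [NumberField K] : Prop :=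
  NumberField.IsTotallyComplex K ∧ Module.finrank ℚ K = 2

/-- The rung's class: totally real OR imaginary quadratic. [folklore] -/
def TotallyRealOrImagQuadClass : ∀ (K : Type) [Field K] [NumberField K], Prop :=
  fun K _ _ => NumberField.IsTotallyReal K ∨ IsImaginaryQuadratic K

/-! ## 2. The rung family (clause (B), `Symᵐ`-sector of regular algebraic `π` on `GL₂`, a.e.-Satake form) -/

/-- **Clause (B) on the `Symᵐ`-sector of regular algebraic cuspidal `π` on `GL₂(𝔸_K)`** (one degree `m`, one
field `K`): for every regular algebraic cuspidal `π` on `GL₂(𝔸_K)`, every prime `ℓ`, `ι : ℚ̄_ℓ ≃+* ℂ` and every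
IRREDUCIBLE `ρ : Γ_K → GL_{m+1}(ℚ̄_ℓ)` that is de Rham above `ℓ` (pinned Fontaine datum) and whose arithmetic
Frobenius at a.e. finite place `v` has characteristic polynomial the `ι`-Satake polynomial of
`Symᵐ{a, b} = symmPowerParams m a b`, `{a, b}` the Satake pair of `π_v`: there is an automorphic representation
`P` of `GL_{m+1}(𝔸_K)` (Borel–Jacquet datum) Satake–Frobenius compatible with `ρ` at a.e. `v`. -/
def SymmPowerRASectorB (m : ℕ) (K : Type) [Field K] [NumberField K] : Prop :=
  ∀ (h2 : isCompact_glFiniteIntegralLevel 2 K) (π : CuspidalAutomorphicRepData 2 K h2),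
    π.1.IsRegularAlgebraic →
    ∀ (ℓ : ℕ) [Fact ℓ.Prime] (ι : PadicAlgCl ℓ ≃+* ℂ) (ρ : FramedGaloisRep K (PadicAlgCl ℓ) (m + 1)),
      ρ.toGaloisRep.IsIrreducible →
      (∀ (v : HeightOneSpectrum (𝓞 K)) (hv : ((ℓ : ℕ) : 𝓞 K) ∈ v.asIdeal),
          (fontainePstAdicCompletion v ℓ hv).IsDeRhamFramed (ρ.toLocal v)) →
      (∀ᶠ v : HeightOneSpectrum (𝓞 K) in cofinite, ∃ a b : ℂ, π.1.HasSatakeParamAt v {a, b} ∧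
          ρ.IsUnramifiedAt v ∧
          ρ.HasFrobCharpolyAt v (arithFrobPolyOfSatake ι v.residueCard 1 (symmPowerParams m a b))) →
      ∀ hm : isCompact_glFiniteIntegralLevel (m + 1) K,
        ∃ P : AutomorphicRepData (AutomorphyDatum.gl (m + 1) K hm),
          ∀ᶠ v : HeightOneSpectrum (𝓞 K) in cofinite, SatakeFrobCompatibleAt ι P ρ v

/-- **The RUNG FAMILY over a class `𝒦` of number fields**: all degrees `m ≥ 1` over every field of the class. -/
def SymmPowerRAGaloisToAutomorphicOn (𝒦 : ∀ (K : Type) [Field K] [NumberField K], Prop) : Prop :=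
  ∀ (K : Type) [Field K] [NumberField K], 𝒦 K → ∀ m : ℕ, 1 ≤ m → SymmPowerRASectorB m K

/-- **THE RUNG** (the filed statement): the family over the class "totally real or imaginary quadratic" —
the new (open) cell is `Symᵐ`, `m ≥ 5`, of genuinely Bianchi regular algebraic cuspidal `π`. -/
def BianchiSymmPowerGaloisToAutomorphic : Prop :=
  SymmPowerRAGaloisToAutomorphicOn TotallyRealOrImagQuadClass

/-- Class monotonicity: a bigger class gives a stronger statement. [folklore] -/
theorem symmPowerRAGaloisToAutomorphicOn_mono {𝒦 𝒦' : ∀ (K : Type) [Field K] [NumberField K], Prop}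
    (h𝒦 : ∀ (K : Type) [Field K] [NumberField K], 𝒦 K → 𝒦' K)
    (h : SymmPowerRAGaloisToAutomorphicOn 𝒦') : SymmPowerRAGaloisToAutomorphicOn 𝒦 :=
  fun K _ _ hK => h K (h𝒦 K hK)

/-- The rung implies the floor's family value (totally real ⊆ totally real ∪ imaginary quadratic): the ladder is
ordered. [folklore] -/
@[aesop safe apply]
theorem floorFamily_of_rung (h : BianchiSymmPowerGaloisToAutomorphic) :
    SymmPowerRAGaloisToAutomorphicOn TotallyRealClass :=
  symmPowerRAGaloisToAutomorphicOn_mono (fun _ _ _ hK => Or.inl hK) h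

/-! ## 4. On-path (F4): the summit, and the crux E itself, give every class — in particular the rung -/

/-- Clause (B) at rank `m + 1` for one reciprocity datum gives the degree-`m` cell. [folklore] -/
theorem sectorB_of_galoisToAutomorphic (m : ℕ) {K : Type} [Field K] [NumberField K]
    (Rec : ReciprocityData K)
    (hB : ∀ hcpt : isCompact_glFiniteIntegralLevel (m + 1) K, GaloisToAutomorphic (m + 1) Rec hcpt) :
    SymmPowerRASectorB m K := by
  intro h2 π _ ℓ _ ι ρ hirr hdR hsym hm
  have hgeo : IsGeometricFramed Rec ρ :=
    ⟨hsym.mono fun v hv => by obtain ⟨_, _, _, hur, _⟩ := hv; exact hur, fun v hv => hdR v hv⟩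
  obtain ⟨P, -, hcorr⟩ := hB hm ℓ ι ρ hirr hgeo
  exact ⟨P.1, hcorr.1⟩

/-- `Langlands → SymmPowerRAGaloisToAutomorphicOn 𝒦` for every class `𝒦`. -/
theorem symmPowerRAGaloisToAutomorphicOn_of_langlands (𝒦 : ∀ (K : Type) [Field K] [NumberField K], Prop)
    (hL : _root_.Langlands) : SymmPowerRAGaloisToAutomorphicOn 𝒦 := by
  intro K _ _ _ m _
  obtain ⟨⟨Rec⟩, hall⟩ := hL K
  exact sectorB_of_galoisToAutomorphic m Rec fun hcpt => (hall Rec (m + 1) (Nat.succ_pos m) hcpt).2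

/-- **F4 on-path lemma for the rung**: `Langlands → BianchiSymmPowerGaloisToAutomorphic`. -/
@[aesop safe apply]
theorem BianchiSymmPowerGaloisToAutomorphic_of_Langlands (hL : _root_.Langlands) :
    BianchiSymmPowerGaloisToAutomorphic :=
  symmPowerRAGaloisToAutomorphicOn_of_langlands _ hL

end Summit.Langlands.Langlands.Cruxes.ReciprocityUpToIrreducibility.BianchiSymmPowerGaloisToAutomorphic

end
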